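import Literature.AlgebraicGeometry.Crystalline.BlochEsnaultKerzLifting
import Literature.AlgebraicGeometry.Motives.HodgeSheaves
import Literature.AlgebraicGeometry.Motives.SupersingularAbelianVariety
import Literature.AlgebraicGeometry.Motives.CompleteIntersection
import Literature.AlgebraicGeometry.Motives.HypersurfaceFormsNonsingular
import Literature.AlgebraicGeometry.Motives.UniversalHypersurfaceFamily
import Literature.AlgebraicGeometry.HodgeTheory.AtiyahClassTraceReal
import Literature.AlgebraicGeometry.HodgeTheory.FermatHodgeCharacters
import HarnessLib

/-!
# p-adic semiregular seeds on anchors and on Fermat lifts: the vocabulary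

An importable, `sorry`-free DEFINITIONS module (definition request
`defn-PadicSemiregularLiftFermatSeedDefs`, wanted by the route `HodgeConjecture/PadicSemiregularLift`,
item `stmt-HodgeConjecture-14874` "FermatAnchorAssembly") carrying, over Literature imports only, the
typed vocabulary in which that route states "semiregular seed" claims at `p`-adic anchors, so that
route items can be one-line `Prop`s over the declarations below. Three groups:

1. **Seeds at `p`-adic anchors** (namespace `Literature.AlgebraicGeometry.Crystalline`):
   `HigherSigma` (the components `σ_q`, `q ≥ 2`, of the Buchweitz–Flenner semiregularity map, as
   DATA — degrees `0, 1` are the tree's real maps `HodgeTheory.sigmaZero/sigmaOne`),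
   `IsPadicSemiregular` (`⊕_{q<p} σ_q` injective on `Ext²(E,E)`; with the zero package this IS
   `HodgeTheory.IsZeroOneSemiregular`, `isPadicSemiregular_zero_iff`), `IsPadicAnchor` (smooth
   projective `W(k)`-model, `n + 6 < p`, cohomologically supersingular special fibre, torsion-free
   Hodge cohomology — the hypotheses of Bloch–Esnault–Kerz 2014 Thm. 1.3 plus supersingularity),
   `SeedSpan` (the conclusion shape: `α ∈ K·{bo chᵣ^cris(Eᵢ)} + Lefʳ` for finitely many p-adically
   semiregular finite locally free `Eᵢ` with the BEK Hodge condition), the predicates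
   `SemiregularSeedsOnAnchors C Θ HO`, `AnchorField`, `SemiregularSeedsOnAnchorsAt F C Θ HO`, and the
   anchor-class refinements `IsFermatLift`, `IsRestrictedAnchor`,
   `SemiregularSeedsOnRestrictedAnchors / …OnAbelianAnchors / …OnFermatLifts` (+ bundled
   `SemiregularSeedsOnFermatLiftsAt`) with `semiregularSeedsOnRestrictedAnchors_of/_iff`.
2. **CI-type seeds on the Fermat fourfold** (namespace `Literature.AlgebraicGeometry.Crystalline.FermatLiftSeeds`):
   `CIDatum F m` (Villaflor's "complete intersection type" data `F = Σ fᵢ gᵢ` for a sextic-shape form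
   in six variables) with `H`, `ideal`, `transitionDet` (`det Jac(H)`), `exists_isHomogeneous_H`,
   `ideal_ne_top`, `transitionDet_not_mem_of_colon_eq`; `HasRangeZeroLocus`, `IsHartshorneSerreOf`
   (Hartshorne–Serre bundle of `V₊(f) ∩ X` on real carriers); the character bookkeeping
   `IsTypeTwoTwo`, `IsSaturated` (+ `IsSaturated.isHodge`), `IsEigenpoly`, `charExponent`, `rescale`,
   `CIDatum.IsStableUnder / VisibleAt / IsTranslateOf / LiftsToWitt / Good`; the `p`-adic side
   `IsFermatFourfoldAnchor`, `FermatLiftDictionary` (posited interface), `targetSpan`, and the scope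
   predicates `SemiregularSeedsOnFermatScope C Θ` / `SemiregularSeedsOnFermatScopeAt F C Θ`.
3. API: the unfolding / comparison lemmas named above (all proved).

## Why predicates of `C`, `Θ`, `HO` and not closed `Prop`s (tree convention)

Crystalline cohomology, Berthelot–Ogus, `ch^cris` are the hypothesis structure
`Motives.CrystallineRealization p k`; the higher `σ_q` (`q ≥ 2`) need an `Ω^q`-valued trace on
Mathlib's `Ext` that does not exist yet; "of Hodge origin" needs the comparison with Betti cohomology
along an embedding `K → ℂ`. As prescribed by the header of `Motives/CrystallineRealization` (and as
`BlochEsnaultKerzLifting C`, `MilneRationalityConjecture D` do), every statement about THE classical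
theory is therefore a `Prop`-valued PREDICATE of explicit data `C : CrystallineRealization p k`,
`Θ : HigherSigma k`, `HO` (a closed `∀ C, …` form is refutable by exotic values of the structure).
Whether such a predicate holds at the classical value is the ROUTE's business: this file asserts
nothing — it declares shapes. In particular it introduces NO named fact (`def X : Prop` debt).

## The closed statements of the line `gorenstein-ci-seeds` are deliberately NOT declared here

The request also named six CLOSED statements of that line (`JacobianColonEq`, `SerreBundleExists`,
`SerreBundleIsOneSemiregular`, `LinearCycleSupply`, `EigenCISupply`, `SemiregularSeedsOnFermatScope`).
They are obligations of the route (line stubs S1–S4b below the item layer, resp. the crux child), not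
known mathematics to vendor: S3 is open in print ("it is not known if the complete intersection
subvarieties are semi-regular", Villaflor 2022 p. 4), S4b is the line's open bet, and the scope
statement is the crux child itself; S1/S2/S4a are being proved problem-side by the line as theorems.
A Literature `def X : Prop` is a named FACT with a printed proof, so none of the six is minted here;
each is a one-liner over this vocabulary (all binders as in the line file):
* S1  `JacobianColonEq`: `… (Z : CIDatum F m), (jacobianIdeal F).colon {Z.transitionDet} = Z.ideal`;
* S2  `SerreBundleExists`: `… ∃ E (hE : IsFiniteLocallyFree E), HasRank E 2 ∧ IsHartshorneSerreOf ι Z.f E`;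
* S3  `SerreBundleIsOneSemiregular`: `… IsHartshorneSerreOf ι Z.f E → HodgeTheory.IsOneSemiregular hE`;
* S4a `LinearCycleSupply`: `… FermatCharacter.IsPaired a → ∃ Z : CIDatum (fermatPolynomial k 4 m) m,
      Z.VisibleAt a ∧ Z.LiftsToWitt p`;
* S4b `EigenCISupply`: `… IsSaturated m a → ¬ FermatCharacter.IsPaired a → ∃ Z, Z.VisibleAt a ∧ Z.Good p a`;
* scope: `SemiregularSeedsOnFermatScope` (closed) `= ∀ F C Θ, SemiregularSeedsOnFermatScopeAt F C Θ`.

## Dictionary to the route's work files (names kept; what changed)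

* `Cruxes/SemiregularSeedsOnAnchors/TypedCrux.lean` (namespace `…Cruxes.SemiregularSeedsOnAnchors`):
  all declarations, verbatim, now in `Literature.AlgebraicGeometry.Crystalline`.
* `Cruxes/SemiregularSeedsOnAnchors/Disproof.lean` §H6 (namespace `…Disproof.Repair`): `IsFermatLift`,
  `IsRestrictedAnchor`, `SemiregularSeedsOnRestrictedAnchors(_of/_iff)`, `…OnAbelianAnchors`,
  `…OnFermatLifts`, verbatim, in `Literature.AlgebraicGeometry.Crystalline` (no `Repair` segment).
* `Cruxes/SemiregularSeedsOnAnchors/Lines/gorenstein-ci-seeds.lean` §1–§4 (namespace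
  `…GorensteinCiSeeds`): in `Literature.AlgebraicGeometry.Crystalline.FermatLiftSeeds`, verbatim EXCEPT
  that notions the tree already has are REUSED instead of re-declared: `jacobianIdeal` IS
  `Motives.UniversalHypersurface.jacobianIdeal` (same body, `Fin (5+1) = Fin 6`); `IsAdmissible m a` ↦
  `HodgeTheory.FermatCharacter.IsAdmissible a`; `IsTotallyHodge m a` ↦ `FermatCharacter.IsHodge a`
  (which also carries admissibility; `IsSaturated.isHodge`); `IsThreePair m a` ↦
  `FermatCharacter.IsPaired a` (a fixed-point-free involution pairing `aᵢ` with `−aᵢ`; on `Fin 6` this is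
  "three pairs"); `IsTypeTwoTwo m a` is spelled through `FermatCharacter.normSum` (`isTypeTwoTwo_iff`).

## References

* R.-O. Buchweitz, H. Flenner, *A semiregularity map for modules and applications to deformations*,
  Compositio Math. 137 (2003), §1, Def. 4.1, §5. [`BuchweitzFlenner2003`]
* S. Bloch, *Semi-regularity and de Rham cohomology*, Invent. Math. 17 (1972). [`Bloch1972Semiregularity`]
* S. Bloch, H. Esnault, M. Kerz, Invent. math. 195 (2014) (arXiv:1203.2776), Thm. 1.3; Remarks 35 (2) of the
  arXiv version (torsion-free Hodge cohomology). [`BlochEsnaultKerz2014pAdic`]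
* P. Berthelot, A. Ogus, Invent. Math. 72 (1983), (2.4)–(2.5). [`BerthelotOgus1983`]
* A. Ogus, *Hodge cycles and crystalline cohomology*, LNM 900 (1982), §3–§4. [`Ogus1982`]
* R. Villaflor Loyola, *Periods of complete intersection algebraic cycles*, manuscripta math. 167
  (2022) (arXiv:1812.03964): Thm. 1, Thm. 2, Rem. 1, Cor. 3, Cor. 4, p. 4. [`Villaflor2022PeriodsCI`]
* E. Arrondo, *A home-made Hartshorne–Serre correspondence*, Rev. Mat. Complut. 20 (2007)
  (arXiv:math/0610015, read: Theorem 1). [`Arrondo2007HartshorneSerre`]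
* T. Shioda, Math. Ann. 245 (1979), §1, Thm. I. [`Shioda1979HodgeFermat`];
  T. Shioda, T. Katsura, *On Fermat varieties*, Tôhoku Math. J. 31 (1979) (not held, acq-03582;
  supersingularity of `X^n_m` when `p^ν ≡ −1 mod m`, cited in prose only). [`ShiodaKatsura1979`];
  Z. Ran, Compositio Math. 42 (1980). [`Ran1980`]
-/

noncomputable section

open CategoryTheory CategoryTheory.Abelian AlgebraicGeometry Opposite
open scoped Isocrystal
open Literature.AlgebraicGeometry.Motives Literature.AlgebraicGeometry.Motives.WittScheme
open Literature.AlgebraicGeometry.Motives.UniversalHypersurface (jacobianIdeal)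
open Literature.AlgebraicGeometry.HodgeTheory Literature.AlgebraicGeometry.Modules

universe u

namespace Literature.AlgebraicGeometry.Crystalline

/-! ## 1. p-adic semiregularity on real carriers (degrees 0, 1 real; degrees ≥ 2 as data) -/

/-- The HIGHER components of the crystalline Buchweitz–Flenner semiregularity map, as data: for every
`k`-scheme `X`, finite locally free `E` and `q` (meant: `2 ≤ q`), an additive map
`σ_q : Ext²_{𝒪_X}(E, E) → H^{q+2}(X, Ω^q_{X/k})` on the tree's real groups (intended value:
`σ_q(ξ) = (−1)^q tr(ξ ∘ At(E)^q)/q!`; not constructible at this pin: no `Ω^q`-valued trace on `Ext`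
for `q ≥ 2`). Degrees `0` and `1` are NOT data: see `IsPadicSemiregular`.
[cite: BuchweitzFlenner2003, Def. 4.1] -/
structure HigherSigma (k : Type u) [Field k] where
  /-- `σ_q` on `Ext²(E, E)`, `q ≥ 2` intended. -/
  sigma : ∀ (X : SchemeOver k) (E : X.left.Modules), IsFiniteLocallyFree E → ∀ q : ℕ,
    Ext.{u + 1} E E 2 →+ hodgeCohomology X q (q + 2)

/-- The zero package `σ_q = 0` (`q ≥ 2`): with it `IsPadicSemiregular` is the tree's real
`{0,1}`-semiregularity (`isPadicSemiregular_zero_iff`). [folklore] -/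
instance (k : Type u) [Field k] : Zero (HigherSigma k) := ⟨⟨fun _ _ _ _ => 0⟩⟩

section Semiregular

variable {k : Type u} [Field k]

/-- `σ_q` of the zero package is `0`. [folklore] -/
@[simp] theorem HigherSigma.zero_sigma (X : SchemeOver k) (E : X.left.Modules)
    (hE : IsFiniteLocallyFree E) (q : ℕ) : (0 : HigherSigma k).sigma X E hE q = 0 := rfl

/-- `E` (finite locally free on the `k`-scheme `X`) is **p-adically semiregular**: the joint kernel of
the REAL components `σ₀ = Tr : Ext²(E,E) → H²(X, 𝒪)` (`HodgeTheory.sigmaZero`),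
`σ₁ = Tr(At ∘ −) : Ext²(E,E) → H³(X, Ω¹)` (`HodgeTheory.sigmaOne`) and the higher components `σ_q`,
`2 ≤ q < p`, of `Θ` is zero — i.e. `⊕_{q<p} σ_q` is injective (Buchweitz–Flenner's `I`-semiregularity
for `I = {0, …, p−1}`, on the carriers that exist). [cite: BuchweitzFlenner2003, Def. 4.1 and §5 (I-semiregular)] -/
def IsPadicSemiregular (Θ : HigherSigma k) (p : ℕ) (X : SchemeOver k) {E : X.left.Modules}
    (hE : IsFiniteLocallyFree E) : Prop :=
  ∀ x : Ext.{u + 1} E E 2, sigmaZero hE x = 0 → sigmaOne hE x = 0 →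
    (∀ q : ℕ, 2 ≤ q → q < p → Θ.sigma X E hE q x = 0) → x = 0

/-- `{0,1}`-semiregular (real carriers) ⇒ p-adically semiregular for every `Θ` and `p`. [folklore] -/
theorem isPadicSemiregular_of_isZeroOneSemiregular (Θ : HigherSigma k) (p : ℕ) (X : SchemeOver k)
    {E : X.left.Modules} (hE : IsFiniteLocallyFree E) (h : IsZeroOneSemiregular.{u + 1} hE) :
    IsPadicSemiregular Θ p X hE := by
  intro x h0 h1 _
  exact (isZeroOneSemiregular_iff hE).1 h x h0 h1

/-- With the zero package, p-adic semiregularity IS `{0,1}`-semiregularity. [folklore] -/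
theorem isPadicSemiregular_zero_iff (p : ℕ) (X : SchemeOver k) {E : X.left.Modules}
    (hE : IsFiniteLocallyFree E) :
    IsPadicSemiregular (0 : HigherSigma k) p X hE ↔ IsZeroOneSemiregular.{u + 1} hE := by
  rw [isZeroOneSemiregular_iff]
  constructor
  · intro h x h0 h1
    exact h x h0 h1 fun _ _ _ => rfl
  · intro h x h0 h1 _
    exact h x h0 h1

end Semiregular

/-! ## 2. Anchors, seed spans, the seed predicates -/

section Anchors

variable {k : Type u} [Field k] {p : ℕ} [Fact p.Prime] [CharP k p] [PerfectRing k p]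

/-- **p-adic anchor of dimension `n`**: `𝒳/W(k)` a smooth proper model of relative dimension `n`
(`WittScheme.IsSmoothProperModel`: both fibres smooth projective geometrically integral), projective
over `W` (`IsProjectiveOverRing`), `n + 6 < p`, with (i) COHOMOLOGICALLY SUPERSINGULAR special fibre
(every crystalline class is algebraic: `C.algebraicClasses X_k r = ⊤`, i.e. `ρ_r = b_{2r}`) and
(ii) `p`-torsion-free Hodge cohomology `H^b(𝒳, Ω^a_{𝒳/W})` for all `a, b` (`Motives.hodgeCohomology`
of the `W`-scheme `𝒳`). The smooth-projective / `p > n + 6` / torsion-free clauses are exactly the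
hypotheses of Bloch–Esnault–Kerz 2014, Thm. 1.3, with the torsion-freeness variant of their Remarks 35 (2)
(arXiv numbering); supersingularity is
the route's restriction (notion posited by route `PadicSemiregularLift`, crux `SemiregularSeedsOnAnchors`).
[cite: BlochEsnaultKerz2014pAdic, Thm. 1.3 (hypotheses)] -/
structure IsPadicAnchor (C : CrystallineRealization p k) (n : ℕ) (𝒳 : SchemeOver (WittVector p k)) :
    Prop where
  /-- smooth proper model, both fibres smooth projective geometrically integral of dimension `n` -/
  model : IsSmoothProperModel n 𝒳
  /-- projective over `W` -/
  projective : IsProjectiveOverRing 𝒳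
  /-- `n + 6 < p` -/
  dim_lt : n + 6 < p
  /-- (i) cohomologically supersingular special fibre -/
  supersingular : ∀ r : ℕ, C.algebraicClasses (specialFibre 𝒳) r = ⊤
  /-- (ii) torsion-free Hodge cohomology of `𝒳/W` -/
  torsionFree : ∀ (a b : ℕ) (x : hodgeCohomology 𝒳 a b), (p : ℤ) • x = 0 → x = 0

/-- The SEED SPAN of `(𝒳, r, α)` (the conclusion shape of every seed statement of the route): finitely
many finite locally free, p-adically semiregular `E_i` on `X_k` with the Bloch–Esnault–Kerz Hodge
condition in all degrees (`C.HodgeCondition 𝒳 E_i`) such that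
`α ∈ K-span{bo ch_r^cris(E_i)} + Lef^r(X_K)` (`Lef^r = C.dR.lefschetzClasses`, the `K`-span of `r`-fold
products of divisor classes). [folklore] -/
def SeedSpan (C : CrystallineRealization p k) (Θ : HigherSigma k) (𝒳 : SchemeOver (WittVector p k))
    (r : ℕ) (α : C.dR.obj (genericFibre 𝒳) (2 * r)) : Prop :=
  ∃ (m : ℕ) (E : Fin m → (specialFibre 𝒳).left.Modules) (hE : ∀ i, IsFiniteLocallyFree (E i)),
    (∀ i, IsPadicSemiregular Θ p (specialFibre 𝒳) (hE i) ∧ C.HodgeCondition 𝒳 (E i)) ∧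
    α ∈ Submodule.span K(p, k)
        (Set.range fun i => C.bo 𝒳 (2 * r) (C.chCris (specialFibre 𝒳) (E i) r)) ⊔
      C.dR.lefschetzClasses (genericFibre 𝒳) r

/-- Monotonicity of the seed span in the package: a seed family for the zero package (i.e. with
`{0,1}`-semiregular members) is a seed family for every `Θ`. [folklore] -/
theorem SeedSpan.of_zero {C : CrystallineRealization p k} (Θ : HigherSigma k)
    {𝒳 : SchemeOver (WittVector p k)} {r : ℕ} {α : C.dR.obj (genericFibre 𝒳) (2 * r)}
    (h : SeedSpan C 0 𝒳 r α) : SeedSpan C Θ 𝒳 r α := by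
  obtain ⟨m, E, hE, hsr, hα⟩ := h
  refine ⟨m, E, hE, fun i => ⟨?_, (hsr i).2⟩, hα⟩
  exact isPadicSemiregular_of_isZeroOneSemiregular Θ p _ (hE i)
    ((isPadicSemiregular_zero_iff p _ (hE i)).1 (hsr i).1)

/-- **`SemiregularSeedsOnAnchors`** (predicate on the classical data `C`, `Θ`, `HO`; module docstring):
for every `p`-adic anchor `(𝒳/W(k), n)` over the algebraically closed field `k`, every `r` and every
`α ∈ F^r H^{2r}_dR(X_K/K)` (`C.dR.fil (2r) r`) that is (a) φ-Tate ON THE NOSE — `α = bo x` with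
`x ∈ C.tateClasses X_k r` (`φ x = p^r x`) — and (b) of Hodge origin (`HO α`; intended meaning:
`α ⊗_{K,ι} 1` is the de Rham component of a rational `(r,r)`-class on `X_K ⊗_ι ℂ` for some `ι : K → ℂ`;
load-bearing), the seed span holds. This is the typed transcription of the route item
`PadicSemiregularLift.SemiregularSeedsOnAnchors` (refuted AS FILED at a non-Fermat, non-abelian anchor;
kept because every line and both repairs below are phrased against it). [folklore] -/
def SemiregularSeedsOnAnchors [IsAlgClosed k] (C : CrystallineRealization p k) (Θ : HigherSigma k)
    (HO : ∀ ⦃𝒳 : SchemeOver (WittVector p k)⦄ ⦃i : ℕ⦄, C.dR.obj (genericFibre 𝒳) i → Prop) : Prop :=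
  ∀ (n : ℕ) (𝒳 : SchemeOver (WittVector p k)), IsPadicAnchor C n 𝒳 →
    ∀ (r : ℕ) (α : C.dR.obj (genericFibre 𝒳) (2 * r)),
      α ∈ C.dR.fil (2 * r) r →
      (∃ x ∈ C.tateClasses (specialFibre 𝒳) r, C.bo 𝒳 (2 * r) x = α) →
      HO α →
      SeedSpan C Θ 𝒳 r α

end Anchors

/-! ### Bundled ground-field data

A route skeleton audit admits DATA binders but no `Prop`-class hypotheses (`Fact p.Prime`, `CharP k p`,
`PerfectRing k p`, `IsAlgClosed k` are `Prop`s); the bundled forms below pack the ground field and its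
instances into one data binder `F : AnchorField`. -/

/-- Ground-field data of an anchor: a prime `p` and an algebraically closed (perfect) field `k` of
characteristic `p`, with the instances as fields (re-registered as instances on the projections just
below), so that
`CrystallineRealization F.p F.k` elaborates. Intended value: `(p, 𝔽̄_p)`. [folklore] -/
structure AnchorField : Type (u + 1) where
  /-- the residue characteristic -/
  p : ℕ
  [fact : Fact p.Prime]
  /-- the residue field (intended `𝔽̄_p`; any algebraically closed field of characteristic `p`) -/
  k : Type u
  [field : Field k]
  [charP : CharP k p]
  [perfect : PerfectRing k p]
  [algClosed : IsAlgClosed k]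

namespace AnchorField

/-- `F.p` is prime. [folklore] -/
instance instFactPrime (F : AnchorField.{u}) : Fact F.p.Prime := F.fact

/-- `F.k` is a field. [folklore] -/
instance instField (F : AnchorField.{u}) : Field F.k := F.field

/-- `F.k` has characteristic `F.p`. [folklore] -/
instance instCharP (F : AnchorField.{u}) : CharP F.k F.p := F.charP

/-- `F.k` is perfect. [folklore] -/
instance instPerfectRing (F : AnchorField.{u}) : PerfectRing F.k F.p := F.perfect

/-- `F.k` is algebraically closed. [folklore] -/
instance instIsAlgClosed (F : AnchorField.{u}) : IsAlgClosed F.k := F.algClosed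

end AnchorField

/-- **`SemiregularSeedsOnAnchors`, bundled**: the same predicate with `(p, k, instances)` packed in `F`
(`semiregularSeedsOnAnchorsAt_iff`). [folklore] -/
def SemiregularSeedsOnAnchorsAt (F : AnchorField.{u}) (C : CrystallineRealization F.p F.k)
    (Θ : HigherSigma F.k)
    (HO : ∀ ⦃𝒳 : SchemeOver (WittVector F.p F.k)⦄ ⦃i : ℕ⦄, C.dR.obj (genericFibre 𝒳) i → Prop) : Prop :=
  SemiregularSeedsOnAnchors C Θ HO

/-- The bundled predicate IS the unbundled one. [folklore] -/
theorem semiregularSeedsOnAnchorsAt_iff (F : AnchorField.{u}) (C : CrystallineRealization F.p F.k)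
    (Θ : HigherSigma F.k)
    (HO : ∀ ⦃𝒳 : SchemeOver (WittVector F.p F.k)⦄ ⦃i : ℕ⦄, C.dR.obj (genericFibre 𝒳) i → Prop) :
    SemiregularSeedsOnAnchorsAt F C Θ HO ↔ SemiregularSeedsOnAnchors C Θ HO :=
  Iff.rfl

section AnchorsBundled

variable {k : Type u} [Field k] {p : ℕ} [Fact p.Prime] [CharP k p] [PerfectRing k p]

/-- The unbundled predicate at given `(p, k)` is the bundled one at `⟨p, k⟩`. [folklore] -/
theorem semiregularSeedsOnAnchors_iff_at [IsAlgClosed k] (C : CrystallineRealization p k)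
    (Θ : HigherSigma k)
    (HO : ∀ ⦃𝒳 : SchemeOver (WittVector p k)⦄ ⦃i : ℕ⦄, C.dR.obj (genericFibre 𝒳) i → Prop) :
    SemiregularSeedsOnAnchors C Θ HO ↔ SemiregularSeedsOnAnchorsAt (AnchorField.mk p k) C Θ HO :=
  Iff.rfl

end AnchorsBundled

/-! ## 3. Anchor classes: Fermat lifts, abelian schemes, restricted anchors

The two anchor classes the route's assembly actually consumes (refuter's repair, `Disproof.lean` §H6):
(A) ABELIAN SCHEMES over `W` (a group-object structure `GrpObj 𝒳` on the `W`-scheme), for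
`HodgeAbelianVarieties`; (F) the FERMAT LIFTS `X^n_m ⊗ W(k)` with `m ∣ p^ν + 1` (Shioda–Katsura:
the special fibre is then supersingular), for `HodgeFermatVarieties`. -/

section AnchorClasses

variable {k : Type u} [Field k] {p : ℕ} [Fact p.Prime] [CharP k p] [PerfectRing k p]

/-- `𝒳 ≅ V₊(x₀ᵐ + ⋯ + x_{n+1}ᵐ) ⊂ ℙ^{n+1}_W`, `W = W(k)`: the FERMAT LIFT — a closed `W`-immersion
into `projectiveSpaceOver (n+1) W` whose image is the zero locus of the Fermat form (the shape of the
tree's `Motives.IsHypersurfaceCutOutBy` / `IsFermatVariety`, with the field base replaced by the ring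
`W`; reducedness is not demanded here — at an anchor `𝒳` is smooth over `W`). [folklore] -/
def IsFermatLift (n m : ℕ) (𝒳 : SchemeOver (WittVector p k)) : Prop :=
  letI := MvPolynomial.gradedAlgebra (σ := Fin (n + 2)) (R := WittVector p k)
  ∃ ι : 𝒳 ⟶ projectiveSpaceOver (n + 1) (WittVector p k),
    IsClosedImmersion ι.left ∧
      Set.range ι.left.base =
        ProjectiveSpectrum.zeroLocus (MvPolynomial.homogeneousSubmodule (Fin (n + 2)) (WittVector p k))
          {∑ i : Fin (n + 2), MvPolynomial.X i ^ m}

/-- **Restricted anchor**: a `p`-adic anchor which is moreover (A) an ABELIAN SCHEME over `W` (a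
group-object structure on the `W`-scheme) or (F) a FERMAT LIFT `X^n_m ⊗ W` with `2 ≤ m`,
`m ∣ p^ν + 1` for some `ν ≥ 1` (Shioda–Katsura 1979: then the special fibre `X^n_m ⊗ k` is unirational,
hence supersingular). Notion posited by the route (refuter's repair `C′`). [folklore] -/
def IsRestrictedAnchor (C : CrystallineRealization p k) (n : ℕ) (𝒳 : SchemeOver (WittVector p k)) :
    Prop :=
  IsPadicAnchor C n 𝒳 ∧
    (Nonempty (GrpObj 𝒳) ∨ ∃ m ν : ℕ, 2 ≤ m ∧ 1 ≤ ν ∧ m ∣ p ^ ν + 1 ∧ IsFermatLift n m 𝒳)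

/-- **`SemiregularSeedsOnRestrictedAnchors`** (`C′` of the refuter's repair): `SemiregularSeedsOnAnchors`
verbatim with `IsPadicAnchor` replaced by `IsRestrictedAnchor`. [folklore] -/
def SemiregularSeedsOnRestrictedAnchors [IsAlgClosed k] (C : CrystallineRealization p k)
    (Θ : HigherSigma k)
    (HO : ∀ ⦃𝒳 : SchemeOver (WittVector p k)⦄ ⦃i : ℕ⦄, C.dR.obj (genericFibre 𝒳) i → Prop) : Prop :=
  ∀ (n : ℕ) (𝒳 : SchemeOver (WittVector p k)), IsRestrictedAnchor C n 𝒳 →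
    ∀ (r : ℕ) (α : C.dR.obj (genericFibre 𝒳) (2 * r)),
      α ∈ C.dR.fil (2 * r) r →
      (∃ x ∈ C.tateClasses (specialFibre 𝒳) r, C.bo 𝒳 (2 * r) x = α) →
      HO α →
      SeedSpan C Θ 𝒳 r α

/-- `C′` is a weakening of `SemiregularSeedsOnAnchors`. [folklore] -/
theorem semiregularSeedsOnRestrictedAnchors_of [IsAlgClosed k] (C : CrystallineRealization p k)
    (Θ : HigherSigma k)
    (HO : ∀ ⦃𝒳 : SchemeOver (WittVector p k)⦄ ⦃i : ℕ⦄, C.dR.obj (genericFibre 𝒳) i → Prop)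
    (h : SemiregularSeedsOnAnchors C Θ HO) : SemiregularSeedsOnRestrictedAnchors C Θ HO :=
  fun n 𝒳 h𝒳 r α hfil hT hHO => h n 𝒳 h𝒳.1 r α hfil hT hHO

/-- The (A)-half of `C′`: seeds at `p`-adic anchors that are ABELIAN SCHEMES over `W`. [folklore] -/
def SemiregularSeedsOnAbelianAnchors [IsAlgClosed k] (C : CrystallineRealization p k)
    (Θ : HigherSigma k)
    (HO : ∀ ⦃𝒳 : SchemeOver (WittVector p k)⦄ ⦃i : ℕ⦄, C.dR.obj (genericFibre 𝒳) i → Prop) : Prop :=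
  ∀ (n : ℕ) (𝒳 : SchemeOver (WittVector p k)), IsPadicAnchor C n 𝒳 → Nonempty (GrpObj 𝒳) →
    ∀ (r : ℕ) (α : C.dR.obj (genericFibre 𝒳) (2 * r)),
      α ∈ C.dR.fil (2 * r) r →
      (∃ x ∈ C.tateClasses (specialFibre 𝒳) r, C.bo 𝒳 (2 * r) x = α) →
      HO α →
      SeedSpan C Θ 𝒳 r α

/-- The (F)-half of `C′`: seeds ON THE FERMAT LIFTS `X^n_m ⊗ W(k)` themselves (`2 ≤ m`,
`m ∣ p^ν + 1`, `ν ≥ 1`). [folklore] -/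
def SemiregularSeedsOnFermatLifts [IsAlgClosed k] (C : CrystallineRealization p k) (Θ : HigherSigma k)
    (HO : ∀ ⦃𝒳 : SchemeOver (WittVector p k)⦄ ⦃i : ℕ⦄, C.dR.obj (genericFibre 𝒳) i → Prop) : Prop :=
  ∀ (n : ℕ) (𝒳 : SchemeOver (WittVector p k)), IsPadicAnchor C n 𝒳 →
    (∃ m ν : ℕ, 2 ≤ m ∧ 1 ≤ ν ∧ m ∣ p ^ ν + 1 ∧ IsFermatLift n m 𝒳) →
    ∀ (r : ℕ) (α : C.dR.obj (genericFibre 𝒳) (2 * r)),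
      α ∈ C.dR.fil (2 * r) r →
      (∃ x ∈ C.tateClasses (specialFibre 𝒳) r, C.bo 𝒳 (2 * r) x = α) →
      HO α →
      SeedSpan C Θ 𝒳 r α

/-- `C′ ↔ (A-half) ∧ (F-half)`. [folklore] -/
theorem semiregularSeedsOnRestrictedAnchors_iff [IsAlgClosed k] (C : CrystallineRealization p k)
    (Θ : HigherSigma k)
    (HO : ∀ ⦃𝒳 : SchemeOver (WittVector p k)⦄ ⦃i : ℕ⦄, C.dR.obj (genericFibre 𝒳) i → Prop) :
    SemiregularSeedsOnRestrictedAnchors C Θ HO ↔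
      SemiregularSeedsOnAbelianAnchors C Θ HO ∧ SemiregularSeedsOnFermatLifts C Θ HO := by
  constructor
  · intro h
    exact ⟨fun n 𝒳 h𝒳 hG => h n 𝒳 ⟨h𝒳, Or.inl hG⟩, fun n 𝒳 h𝒳 hF => h n 𝒳 ⟨h𝒳, Or.inr hF⟩⟩
  · rintro ⟨hA, hF⟩ n 𝒳 ⟨h𝒳, hG | hFl⟩
    · exact hA n 𝒳 h𝒳 hG
    · exact hF n 𝒳 h𝒳 hFl

end AnchorClasses

/-- **`SemiregularSeedsOnFermatLifts`, bundled** (data binders only: `F : AnchorField`, `C`, `Θ`, `HO`).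
[folklore] -/
def SemiregularSeedsOnFermatLiftsAt (F : AnchorField.{u}) (C : CrystallineRealization F.p F.k)
    (Θ : HigherSigma F.k)
    (HO : ∀ ⦃𝒳 : SchemeOver (WittVector F.p F.k)⦄ ⦃i : ℕ⦄, C.dR.obj (genericFibre 𝒳) i → Prop) : Prop :=
  SemiregularSeedsOnFermatLifts C Θ HO

/-- The bundled (F)-half IS the unbundled one. [folklore] -/
theorem semiregularSeedsOnFermatLiftsAt_iff (F : AnchorField.{u}) (C : CrystallineRealization F.p F.k)
    (Θ : HigherSigma F.k)
    (HO : ∀ ⦃𝒳 : SchemeOver (WittVector F.p F.k)⦄ ⦃i : ℕ⦄, C.dR.obj (genericFibre 𝒳) i → Prop) :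
    SemiregularSeedsOnFermatLiftsAt F C Θ HO ↔ SemiregularSeedsOnFermatLifts C Θ HO :=
  Iff.rfl

/-! ## 4. CI-type seeds on the Fermat fourfold (`k[x₀,…,x₅]`, `X = V₊(F) ⊂ ℙ⁵`) -/

namespace FermatLiftSeeds

/-! ### 4.1 Commutative algebra of CI-type data -/

section Algebra

variable {k : Type u} [Field k]

/-- A REDUCED CI-TYPE DATUM for a form `F` of degree `m` in six variables: homogeneous
`f₁,f₂,f₃,g₁,g₂,g₃ ≠ 0` with `deg fᵢ = dᵢ`, `deg gᵢ = m − dᵢ`, `1 ≤ dᵢ < m` (so `m − dᵢ ≥ 1`, no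
truncated subtraction, and every `gᵢ` is non-constant too), `Σ fᵢ gᵢ = F`, and `(f₁,f₂,f₃)` a radical
ideal (so that the tree's REDUCED `Motives.completeIntersection f` is the complete-intersection scheme
`V₊(f₁,f₂,f₃) ⊂ ℙ⁵`, Villaflor's surface `Z` when `X = V₊(F)` is smooth: a common zero of the `fᵢ, gᵢ`
would be a singular point of `X`, so `(f,g)` is a regular sequence and `(f)` has codimension `3`).
Villaflor's "complete intersection inside `ℙ^{n+1}` contained in `X`, `F = f₁g₁ + ⋯ + f_{n/2+1}g_{n/2+1}`"
at `n = 4`. [cite: Villaflor2022PeriodsCI, Thm. 1 and Def. 4 (complete intersection type)] -/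
structure CIDatum (F : MvPolynomial (Fin 6) k) (m : ℕ) where
  /-- degrees of the `fᵢ` -/
  d : Fin 3 → ℕ
  /-- the forms cutting out `Z` -/
  f : Fin 3 → MvPolynomial (Fin 6) k
  /-- the complementary forms -/
  g : Fin 3 → MvPolynomial (Fin 6) k
  one_le_d : ∀ i, 1 ≤ d i
  d_lt : ∀ i, d i < m
  f_hom : ∀ i, (f i).IsHomogeneous (d i)
  g_hom : ∀ i, (g i).IsHomogeneous (m - d i)
  f_ne : ∀ i, f i ≠ 0
  g_ne : ∀ i, g i ≠ 0
  sum_eq : ∑ i, f i * g i = F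
  radical : (Ideal.span (Set.range f)).IsRadical

namespace CIDatum

variable {F : MvPolynomial (Fin 6) k} {m : ℕ}

/-- The six forms `H = (f₁,f₂,f₃,g₁,g₂,g₃)` (Villaflor's `H = (h₀,…,h_{n+1})`, up to the order of the
entries, which only affects the sign of `det Jac(H)`). [cite: Villaflor2022PeriodsCI, Thm. 1] -/
def H (Z : CIDatum F m) : Fin 6 → MvPolynomial (Fin 6) k :=
  fun i => Sum.elim Z.f Z.g ((finSumFinEquiv (m := 3) (n := 3)).symm (Fin.cast rfl i))

/-- The ideal `⟨f, g⟩ = (H₀, …, H₅)`; `A = k[x]/⟨f,g⟩` is the Artinian Gorenstein algebra attached to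
the datum. [folklore] -/
def ideal (Z : CIDatum F m) : Ideal (MvPolynomial (Fin 6) k) :=
  Ideal.span (Set.range Z.H)

/-- The TRANSITION DETERMINANT `P_Z = det (∂ⱼ Hᵢ)` (Villaflor's `det Jac(H)`: the class `[Z]_prim`
corresponds to `c · P_Z`, `c ≠ 0`, under `H^{2,2}_prim ≅ R^F_{3m−6}`). It is homogeneous of degree
`Σ(dᵢ − 1) + Σ(m − dᵢ − 1) = 3m − 6`. [cite: Villaflor2022PeriodsCI, Thm. 1] -/
def transitionDet (Z : CIDatum F m) : MvPolynomial (Fin 6) k :=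
  Matrix.det (Matrix.of fun i j : Fin 6 => MvPolynomial.pderiv j (Z.H i))

/-- Every `Hᵢ` is homogeneous of POSITIVE degree. [folklore] -/
theorem exists_isHomogeneous_H (Z : CIDatum F m) (i : Fin 6) :
    ∃ n, 0 < n ∧ (Z.H i).IsHomogeneous n := by
  unfold CIDatum.H
  cases (finSumFinEquiv (m := 3) (n := 3)).symm (Fin.cast rfl i) with
  | inl a => exact ⟨Z.d a, Z.one_le_d a, Z.f_hom a⟩
  | inr a => exact ⟨m - Z.d a, Nat.sub_pos_of_lt (Z.d_lt a), Z.g_hom a⟩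

/-- `⟨f, g⟩` is a proper ideal (all generators have positive degree: constant coefficients vanish).
[folklore] -/
theorem ideal_ne_top (Z : CIDatum F m) : Z.ideal ≠ ⊤ := by
  intro htop
  have key : ∀ q ∈ Z.ideal, MvPolynomial.constantCoeff q = 0 := by
    intro q hq
    refine Submodule.span_induction ?_ ?_ ?_ ?_ hq
    · rintro _ ⟨i, rfl⟩
      obtain ⟨n, hn, hhom⟩ := Z.exists_isHomogeneous_H i
      rw [MvPolynomial.constantCoeff_eq]
      exact hhom.coeff_eq_zero (by rw [map_zero]; exact hn.ne)
    · simp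
    · intro x y _ _ hx hy
      simp [hx, hy]
    · intro a x _ hx
      simp [hx]
  have h1 : (1 : MvPolynomial (Fin 6) k) ∈ Z.ideal := htop ▸ Submodule.mem_top
  simpa using key 1 h1

end CIDatum

/-- Linkage corollary recorded for the provers: `P_Z ∉ J^F` follows from `(J^F : P_Z) = ⟨f,g⟩ ≠ (1)`
(the Jacobian ideal is the tree's `Motives.UniversalHypersurface.jacobianIdeal`; `P_Z ∉ J^F` is
`[Z]_prim ≠ 0`, Villaflor Cor. 2 (i)). [cite: Villaflor2022PeriodsCI, Rem. 1 and Cor. 2 (i)] -/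
theorem transitionDet_not_mem_of_colon_eq {F : MvPolynomial (Fin 6) k} {m : ℕ} (Z : CIDatum F m)
    (hcolon : (jacobianIdeal F).colon {Z.transitionDet} = Z.ideal) :
    Z.transitionDet ∉ jacobianIdeal F := by
  intro hmem
  apply Z.ideal_ne_top
  rw [← hcolon, eq_top_iff]
  intro r _
  rw [Submodule.mem_colon]
  rintro q rfl
  exact Ideal.mul_mem_left _ r hmem

end Algebra

/-! ### 4.2 Geometry: zero loci in `ℙ⁵` and Hartshorne–Serre bundles (real carriers) -/

section Geometry

variable {k : Type u} [Field k]

/-- `ι : X ⟶ ℙ⁵_k` has image the zero locus `V₊(F)` — the range clause of the tree's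
`Motives.IsHypersurfaceCutOutBy` for a GIVEN `ι` (`isHypersurfaceCutOutBy_iff`). [folklore] -/
def HasRangeZeroLocus {X : SchemeOver k} (ι : X ⟶ projectiveSpace 5 k)
    (F : MvPolynomial (Fin 6) k) : Prop :=
  letI := MvPolynomial.gradedAlgebra (σ := Fin 6) (R := k)
  Set.range ι.left.base =
    ProjectiveSpectrum.zeroLocus (MvPolynomial.homogeneousSubmodule (Fin 6) k) {F}

/-- `IsHypersurfaceCutOutBy 5 F X` unfolds to: `X` reduced and some closed immersion `ι : X ↪ ℙ⁵`
with `HasRangeZeroLocus ι F`. [folklore] -/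
theorem isHypersurfaceCutOutBy_iff (F : MvPolynomial (Fin 6) k) (X : SchemeOver k) :
    IsHypersurfaceCutOutBy 5 F X ↔
      IsReduced X.left ∧ ∃ ι : X ⟶ projectiveSpace 5 k, IsClosedImmersion ι.left ∧
        HasRangeZeroLocus ι F :=
  Iff.rfl

/-- `E` IS A HARTSHORNE–SERRE BUNDLE OF `Z = V₊(f) ∩ X` (through the FIXED embedding `ι`), on real
carriers: the reduced complete intersection `completeIntersection f ↪ ℙ⁵` factors through `X` by some
`j`, and there are a line bundle `L` on `X`, a line bundle `L_Z` on `Z` and maps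
`𝒪_X →ˢ E →ᵗ L →ᵛ j_*L_Z` with `s` mono, `v` epi, and `(s,t)`, `(t,v)` exact. Then `v♭ : j^*L → L_Z` is
an epimorphism of line bundles, hence an isomorphism, so `im t = ker v = 𝓘_Z·L`, i.e.
`0 → 𝒪_X → E → 𝓘_Z ⊗ L → 0` is the Hartshorne–Serre extension of Arrondo's Theorem 1 (a rank-two
bundle with a section vanishing exactly on the codimension-two local complete intersection `Z`, with
`∧² E = L`). [cite: Arrondo2007HartshorneSerre, Thm. 1 (r = 2; arXiv:math/0610015 numbering)] -/
def IsHartshorneSerreOf {X : SchemeOver k} (ι : X ⟶ projectiveSpace 5 k)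
    (f : Fin 3 → MvPolynomial (Fin 6) k) (E : X.left.Modules) : Prop :=
  ∃ (j : completeIntersection f ⟶ X) (_ : j ≫ ι = completeIntersectionι f)
    (L : X.left.Modules) (_ : HasRank L 1)
    (LZ : (completeIntersection f).left.Modules) (_ : HasRank LZ 1)
    (s : unitModule X.left ⟶ E) (t : E ⟶ L)
    (v : L ⟶ (Scheme.Modules.pushforward j.left).obj LZ)
    (hst : s ≫ t = 0) (htv : t ≫ v = 0),
    Mono s ∧ Epi v ∧ (ShortComplex.mk s t hst).Exact ∧ (ShortComplex.mk t v htv).Exact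

end Geometry

/-! ### 4.3 Characters of the Fermat fourfold `X⁴_m` and CI-type supply (combinatorics / algebra)

Characters are `a : (ℤ/m)⁶` (`Fin 6 → ZMod m`); admissibility `aᵢ ≠ 0, Σ aᵢ = 0`, the totally-Hodge
condition and pairedness are the tree's `HodgeTheory.FermatCharacter.IsAdmissible / IsHodge / IsPaired`. -/

section Characters

variable {k : Type u} [Field k]

/-- `a` is of HODGE TYPE `(2,2)`: `Σᵢ ⟨aᵢ/m⟩ = 3`, i.e. `Σ val(aᵢ) = 3m`
(`FermatCharacter.normSum a = 3m`; `V_a ⊂ H^{p,q}` with `q + 1 = Σ val(aᵢ)/m`).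
[cite: Shioda1979HodgeFermat, Thm. I] -/
def IsTypeTwoTwo (m : ℕ) (a : Fin 6 → ZMod m) : Prop :=
  FermatCharacter.normSum a = 3 * m

/-- Unfolding: `IsTypeTwoTwo m a ↔ Σ val(aᵢ) = 3m`. [folklore] -/
theorem isTypeTwoTwo_iff (m : ℕ) (a : Fin 6 → ZMod m) :
    IsTypeTwoTwo m a ↔ ∑ i, (a i).val = 3 * m :=
  Iff.rfl

/-- SATURATED character: admissible, and every multiple `j·a` WITHOUT A ZERO ENTRY is of type
`(2,2)` — then the class of an `H_a`-stable cycle (supported on the characters `ℤ·a`) is automatically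
in `F²`. Saturated ⇒ Hodge character (`IsSaturated.isHodge`). (Notion posited by the route's line
`gorenstein-ci-seeds`; e.g. for prime `m` every Hodge character is paired, `FermatCharacter.IsHodge.isPaired`,
and paired characters are saturated.) [folklore] -/
def IsSaturated (m : ℕ) (a : Fin 6 → ZMod m) : Prop :=
  FermatCharacter.IsAdmissible a ∧
    ∀ j : ZMod m, (∀ i, j * a i ≠ 0) → IsTypeTwoTwo m (fun i => j * a i)

/-- Saturated characters are Hodge characters (`𝔅⁴_m`: unit multiples have no zero entry, and
`normSum = 3m` is `2 · normSum = 6m`). [folklore] -/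
theorem IsSaturated.isHodge {m : ℕ} {a : Fin 6 → ZMod m} (h : IsSaturated m a) :
    FermatCharacter.IsHodge a := by
  refine ⟨h.1, fun t => ?_⟩
  have ht : IsTypeTwoTwo m (fun i => (t : ZMod m) * a i) :=
    h.2 (t : ZMod m) fun i hti => h.1.1 i ((Units.mul_right_eq_zero t).mp hti)
  unfold IsTypeTwoTwo at ht
  omega

/-- `P` is an `H_a`-EIGENPOLYNOMIAL (`H_a = ker(a) ⊂ (ℤ/m)⁶` acting diagonally; no root of unity is
needed to say it): any two monomials of `P` have exponents differing by a multiple of `a` mod `m`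
(`(ker a)^⊥ = ℤ·a`). [folklore] -/
def IsEigenpoly (m : ℕ) (a : Fin 6 → ZMod m) (P : MvPolynomial (Fin 6) k) : Prop :=
  ∀ e ∈ P.support, ∀ e' ∈ P.support,
    ∃ j : ZMod m, ∀ i, ((e i : ℕ) : ZMod m) - ((e' i : ℕ) : ZMod m) = j * a i

/-- The exponent `a − 1 = (val a₀ − 1, …, val a₅ − 1)` (for admissible `a` every `val aᵢ ≥ 1`, so the
subtraction does not truncate): the monomial `x^{a−1}` spans the `a`-eigenline of
`R^F_{3m−6} ≅ H^{2,2}_prim` for the Fermat form (`J^F = (xᵢ^{m−1})`, basis `x^β`, `βᵢ ≤ m − 2`; the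
residue `x^β Ω / F³` has character `β + 1`). [cite: Shioda1979HodgeFermat, §1] -/
def charExponent (m : ℕ) (a : Fin 6 → ZMod m) : Fin 6 →₀ ℕ :=
  Finsupp.equivFunOnFinite.symm fun i => (a i).val - 1

/-- Unfolding `charExponent`. [folklore] -/
@[simp] theorem charExponent_apply (m : ℕ) (a : Fin 6 → ZMod m) (i : Fin 6) :
    charExponent m a i = (a i).val - 1 := rfl

/-- Rescaling the variables, `xᵢ ↦ cᵢ xᵢ` (the diagonal action of `μ_m⁶` when `cᵢ^m = 1`). [folklore] -/
def rescale (c : Fin 6 → k) : MvPolynomial (Fin 6) k →ₐ[k] MvPolynomial (Fin 6) k :=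
  MvPolynomial.aeval fun i => MvPolynomial.C (c i) * MvPolynomial.X i

/-- `rescale c` on a variable. [folklore] -/
@[simp] theorem rescale_X (c : Fin 6 → k) (i : Fin 6) :
    rescale c (MvPolynomial.X i) = MvPolynomial.C (c i) * MvPolynomial.X i := by
  simp [rescale]

namespace CIDatum

variable {m : ℕ}

/-- `Z` is `H_a`-STABLE: all six forms are `H_a`-eigenpolynomials. [folklore] -/
def IsStableUnder (Z : CIDatum (fermatPolynomial k 4 m) m) (a : Fin 6 → ZMod m) : Prop :=
  (∀ i, IsEigenpoly m a (Z.f i)) ∧ ∀ i, IsEigenpoly m a (Z.g i)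

/-- `Z` is VISIBLE AT `a`: the `x^{a−1}`-coefficient of `P_Z` is non-zero. Since `J^F = (xᵢ^{m−1})`
is a monomial ideal and `val aᵢ − 1 ≤ m − 2`, this coefficient is that of `P_Z mod J^F` in the
monomial basis of `R^F_{3m−6}`, i.e. (dictionary field `visible_span`) the `V_a`-component of
`[Z]_prim` is non-zero. [folklore] -/
def VisibleAt (Z : CIDatum (fermatPolynomial k 4 m) m) (a : Fin 6 → ZMod m) : Prop :=
  MvPolynomial.coeff (charExponent m a) Z.transitionDet ≠ 0

/-- `Z` is a DIAGONAL TRANSLATE of `Z₀` by `m`-th roots of unity (both are data for the Fermat form,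
which is invariant). [folklore] -/
def IsTranslateOf (Z Z₀ : CIDatum (fermatPolynomial k 4 m) m) : Prop :=
  ∃ c : Fin 6 → k, (∀ i, c i ^ m = 1) ∧ (∀ i, Z.f i = rescale c (Z₀.f i)) ∧
    ∀ i, Z.g i = rescale c (Z₀.g i)

/-- `Z` LIFTS TO `W(k)` as a CI-type datum of the Fermat form over the Witt vectors (then the relative
complete intersection `𝒵 ⊂ 𝒳` lifts `Z`, so `cl(Z)` is the specialisation of an algebraic class of
`X_K`: Hodge condition by lifting — the mechanism for LINEAR cycles). [folklore] -/
def LiftsToWitt (p : ℕ) [Fact p.Prime] [CharP k p] (Z : CIDatum (fermatPolynomial k 4 m) m) : Prop :=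
  ∃ f' g' : Fin 3 → MvPolynomial (Fin 6) (WittVector p k),
    (∀ i, (f' i).IsHomogeneous (Z.d i)) ∧ (∀ i, (g' i).IsHomogeneous (m - Z.d i)) ∧
    ∑ i, f' i * g' i = ∑ i : Fin 6, (MvPolynomial.X i : MvPolynomial (Fin 6) (WittVector p k)) ^ m ∧
    (∀ i, MvPolynomial.map (WittVector.constantCoeff : WittVector p k →+* k) (f' i) = Z.f i) ∧
    ∀ i, MvPolynomial.map (WittVector.constantCoeff : WittVector p k →+* k) (g' i) = Z.g i

/-- GOOD at `a`: one of the two mechanisms that make the BEK Hodge condition of `E_Z` automatic —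
`H_a`-stable with `a` saturated (character bookkeeping), or liftable (lifting). [folklore] -/
def Good (p : ℕ) [Fact p.Prime] [CharP k p] (a : Fin 6 → ZMod m)
    (Z : CIDatum (fermatPolynomial k 4 m) m) : Prop :=
  (IsSaturated m a ∧ Z.IsStableUnder a) ∨ Z.LiftsToWitt p

/-- A liftable datum is good at every character. [folklore] -/
theorem Good.of_liftsToWitt (p : ℕ) [Fact p.Prime] [CharP k p] (a : Fin 6 → ZMod m)
    {Z : CIDatum (fermatPolynomial k 4 m) m} (h : Z.LiftsToWitt p) : Z.Good p a :=
  Or.inr h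

end CIDatum

end Characters

/-! ### 4.4 The p-adic side: Fermat fourfold anchors, the dictionary, the scope predicate -/

section Padic

variable {p : ℕ} [Fact p.Prime] {k : Type u} [Field k] [CharP k p] [PerfectRing k p]

/-- A FERMAT FOURFOLD ANCHOR of degree `m`: `𝒳/W(k)` a smooth proper model of relative dimension `4`
whose fibres are Fermat fourfolds of degree `m ≥ 3` (`Motives.IsFermatVariety 4 m`), at a prime
`p > 4 + 6` not dividing `m`, SUPERSINGULAR (`m ∣ p^ν + 1`: Shioda–Katsura, so `X_k` is
cohomologically supersingular and `(p, 𝒳)` is a `p`-adic anchor; torsion-free Hodge cohomology is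
automatic for hypersurfaces). Notion posited by the route's line `gorenstein-ci-seeds`. [folklore] -/
structure IsFermatFourfoldAnchor (p : ℕ) [Fact p.Prime] {k : Type u} [Field k] [CharP k p]
    (m : ℕ) (𝒳 : SchemeOver (WittVector p k)) : Prop where
  /-- smooth proper model of relative dimension `4` -/
  model : IsSmoothProperModel 4 𝒳
  /-- `3 ≤ m` -/
  three_le : 3 ≤ m
  /-- anchor prime: `4 + 6 < p` -/
  prime_gt : 10 < p
  /-- `p ∤ m` -/
  not_dvd : ¬ p ∣ m
  /-- Shioda–Katsura supersingularity -/
  supersingular : ∃ ν : ℕ, m ∣ p ^ ν + 1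
  /-- the special fibre is `X⁴_m / k` -/
  special : IsFermatVariety 4 m (specialFibre 𝒳)
  /-- the generic fibre is `X⁴_m / K` -/
  generic : IsFermatVariety 4 m (genericFibre 𝒳)

omit [PerfectRing k p] in
/-- At a Fermat fourfold anchor `m ≠ 0` in `k`. [folklore] -/
theorem IsFermatFourfoldAnchor.natCast_ne_zero {m : ℕ} {𝒳 : SchemeOver (WittVector p k)}
    (h : IsFermatFourfoldAnchor p m 𝒳) : (m : k) ≠ 0 :=
  fun hm => h.not_dvd ((CharP.cast_eq_zero_iff k p m).mp hm)

omit [PerfectRing k p] in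
/-- At a Fermat fourfold anchor every prime that vanishes in `k` exceeds `6` (the characteristic
hypothesis under which the Jacobian description of `H^{p,q}(X⁴_m)` is used). [folklore] -/
theorem IsFermatFourfoldAnchor.six_lt_of_prime_cast_eq_zero {m : ℕ} {𝒳 : SchemeOver (WittVector p k)}
    (h : IsFermatFourfoldAnchor p m 𝒳) (q : ℕ) (hq : q.Prime) (hq0 : (q : k) = 0) : 6 < q := by
  have hpq : p ∣ q := (CharP.cast_eq_zero_iff k p q).mp hq0
  have hpq' : p = q := (Nat.prime_dvd_prime_iff_eq Fact.out hq).mp hpq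
  have := h.prime_gt
  omega

/-- THE FERMAT-LIFT DICTIONARY (POSITED interface; every field is a theorem about THE classical
crystalline / de Rham theory of the Fermat scheme `𝒳 = V₊(Σxᵢ^m) ⊂ ℙ⁵_W` with its diagonal
`μ_m⁶`-action and the fixed embedding `ι` of its special fibre — a "construction statement", not
provable for an abstract `C`, exactly like `BerthelotOgusLineBundleLifting C`):
* `V a` — the `a`-eigenspace of `H⁴_dR(X_K/K)` (`K ⊇ μ_m` as `p ∤ m`), one-dimensional for admissible
  `a`, inside `H^{p,q}` for `(p,q)` the type of `a` (Shioda 1979 §1; Ogus 1982 §3);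
* `hSq` — `h² = c₁(𝒪(1))²_dR`, a Lefschetz class in `F²`;
* `ciClass Z` — the crystalline class of the cycle of `ι⁻¹ V₊(f) = V₊(f₁,f₂,f₃) ∩ X_k`;
* `chern_two`, `hodge_other` — Riemann–Roch for Hartshorne–Serre bundles: `ch₁ = c·h`,
  `ch₂ = (c²/2) h² − [Z]`, `c = Σdᵢ − m`, and `ch₃, ch₄ ∈ K h³, K h⁴ ⊂ F³, F⁴`, `ch₀ = 2`;
* `hodge_support` — a GOOD datum and all its diagonal translates have `bo(ciClass) ∈ F²`;
* `visible_span` — VISIBILITY ⇒ SPAN: if the `x^{a−1}`-coefficient of `P_{Z₀}` is non-zero then `V_a`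
  lies in the `K`-span of the classes of the diagonal translates of `Z₀` (projector onto the line
  `V_a`; Villaflor's class formula `[Z]^{2,2}_prim = c·P_Z`, `c ≠ 0`).
(Interface posited by the route's line `gorenstein-ci-seeds`.) [cite: Villaflor2022PeriodsCI, Thm. 1 (visible_span, chern_two)] -/
structure FermatLiftDictionary (C : CrystallineRealization p k) (m : ℕ)
    (𝒳 : SchemeOver (WittVector p k)) (ι : specialFibre 𝒳 ⟶ projectiveSpace 5 k) where
  /-- character eigenspaces of `H⁴_dR(X_K/K)` -/
  V : (Fin 6 → ZMod m) → Submodule K(p, k) (C.dR.obj (genericFibre 𝒳) (2 * 2))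
  /-- `h²` on the generic fibre -/
  hSq : C.dR.obj (genericFibre 𝒳) (2 * 2)
  hSq_mem_lefschetz : hSq ∈ C.dR.lefschetzClasses (genericFibre 𝒳) 2
  hSq_mem_fil : hSq ∈ C.dR.fil (2 * 2) 2
  /-- crystalline class of the CI-type cycle `ι⁻¹ V₊(f)` -/
  ciClass : CIDatum (fermatPolynomial k 4 m) m → C.obj (specialFibre 𝒳) (2 * 2)
  chern_two : ∀ (Z : CIDatum (fermatPolynomial k 4 m) m) (E : (specialFibre 𝒳).left.Modules),
    IsFiniteLocallyFree E → HasRank E 2 → IsHartshorneSerreOf ι Z.f E →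
      C.bo 𝒳 (2 * 2) (C.chCris (specialFibre 𝒳) E 2) =
        (((∑ i, (Z.d i : K(p, k))) - m) ^ 2 / 2) • hSq - C.bo 𝒳 (2 * 2) (ciClass Z)
  hodge_other : ∀ (Z : CIDatum (fermatPolynomial k 4 m) m) (E : (specialFibre 𝒳).left.Modules),
    IsFiniteLocallyFree E → HasRank E 2 → IsHartshorneSerreOf ι Z.f E →
      ∀ r : ℕ, r ≠ 2 → C.bo 𝒳 (2 * r) (C.chCris (specialFibre 𝒳) E r) ∈ C.dR.fil (2 * r) r
  hodge_support : ∀ (a : Fin 6 → ZMod m) (Z₀ Z : CIDatum (fermatPolynomial k 4 m) m),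
    Z₀.Good p a → Z.IsTranslateOf Z₀ → C.bo 𝒳 (2 * 2) (ciClass Z) ∈ C.dR.fil (2 * 2) 2
  visible_span : ∀ (a : Fin 6 → ZMod m) (Z₀ : CIDatum (fermatPolynomial k 4 m) m),
    FermatCharacter.IsAdmissible a → Z₀.VisibleAt a →
      V a ≤ Submodule.span K(p, k)
        ((fun Z => C.bo 𝒳 (2 * 2) (ciClass Z)) '' {Z | Z.IsTranslateOf Z₀})

/-- The TARGET SPAN at a Fermat fourfold anchor: `⊕_{a saturated} V_a ⊔ K·h²` — the `K`-span of the
de Rham components of the rational Hodge classes of `X⁴_m(ℂ)` carried by SATURATED `(ℤ/m)^×`-orbits,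
plus `h²`. [folklore] -/
def targetSpan {C : CrystallineRealization p k} {m : ℕ} {𝒳 : SchemeOver (WittVector p k)}
    {ι : specialFibre 𝒳 ⟶ projectiveSpace 5 k} (D : FermatLiftDictionary C m 𝒳 ι) :
    Submodule K(p, k) (C.dR.obj (genericFibre 𝒳) (2 * 2)) :=
  (⨆ a ∈ {a : Fin 6 → ZMod m | IsSaturated m a}, D.V a) ⊔ (K(p, k) ∙ D.hSq)

/-- `h²` lies in the target span. [folklore] -/
theorem hSq_mem_targetSpan {C : CrystallineRealization p k} {m : ℕ} {𝒳 : SchemeOver (WittVector p k)}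
    {ι : specialFibre 𝒳 ⟶ projectiveSpace 5 k} (D : FermatLiftDictionary C m 𝒳 ι) :
    D.hSq ∈ targetSpan D :=
  Submodule.mem_sup_right (Submodule.mem_span_singleton_self D.hSq)

/-- Each saturated eigenspace lies in the target span. [folklore] -/
theorem V_le_targetSpan {C : CrystallineRealization p k} {m : ℕ} {𝒳 : SchemeOver (WittVector p k)}
    {ι : specialFibre 𝒳 ⟶ projectiveSpace 5 k} (D : FermatLiftDictionary C m 𝒳 ι)
    {a : Fin 6 → ZMod m} (ha : IsSaturated m a) : D.V a ≤ targetSpan D :=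
  le_sup_of_le_left (le_iSup₂_of_le a ha le_rfl)

/-- **Seeds on the Fermat-fourfold SCOPE**, as a predicate of `(C, Θ)`: at every supersingular Fermat
fourfold anchor over `k`, for every closed embedding `ι : X_k ↪ ℙ⁵` onto `V₊(Σ xᵢ^m)` and every
dictionary `D`, every class of the target span is in the seed span (codimension `r = 2`). The closed
statement the route's line `gorenstein-ci-seeds` concludes is `∀ F C Θ, SemiregularSeedsOnFermatScopeAt F C Θ`.
[folklore] -/
def SemiregularSeedsOnFermatScope (C : CrystallineRealization p k) (Θ : HigherSigma k) : Prop :=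
  ∀ (m : ℕ) (𝒳 : SchemeOver (WittVector p k)), IsFermatFourfoldAnchor p m 𝒳 →
    ∀ (ι : specialFibre 𝒳 ⟶ projectiveSpace 5 k) (_ : IsClosedImmersion ι.left),
      HasRangeZeroLocus ι (fermatPolynomial k 4 m) →
    ∀ (D : FermatLiftDictionary C m 𝒳 ι), ∀ α ∈ targetSpan D, SeedSpan C Θ 𝒳 2 α

/-- The scope predicate for the zero package implies it for every package `Θ` (seeds that are
`{0,1}`-semiregular are p-adically semiregular for all `Θ`). [folklore] -/
theorem SemiregularSeedsOnFermatScope.of_zero {C : CrystallineRealization p k} (Θ : HigherSigma k)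
    (h : SemiregularSeedsOnFermatScope C 0) : SemiregularSeedsOnFermatScope C Θ :=
  fun m 𝒳 h𝒳 ι hι hrange D α hα => (h m 𝒳 h𝒳 ι hι hrange D α hα).of_zero Θ

end Padic

end FermatLiftSeeds

/-- **Seeds on the Fermat-fourfold scope, bundled** (data binders only: `F : AnchorField`, `C`, `Θ`).
[folklore] -/
def SemiregularSeedsOnFermatScopeAt (F : AnchorField.{u}) (C : CrystallineRealization F.p F.k)
    (Θ : HigherSigma F.k) : Prop :=
  FermatLiftSeeds.SemiregularSeedsOnFermatScope C Θ

/-- The bundled scope predicate IS the unbundled one. [folklore] -/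
theorem semiregularSeedsOnFermatScopeAt_iff (F : AnchorField.{u}) (C : CrystallineRealization F.p F.k)
    (Θ : HigherSigma F.k) :
    SemiregularSeedsOnFermatScopeAt F C Θ ↔ FermatLiftSeeds.SemiregularSeedsOnFermatScope C Θ :=
  Iff.rfl

end Literature.AlgebraicGeometry.Crystalline

end
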